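import Mathlib
import Summits.KontsevichZagierPeriods.Zeta5Search.TS1RayDominance
import Summits.KontsevichZagierPeriods.Zeta5Search.DenomLaw.TS1RayCStar
import Summits.KontsevichZagierPeriods.Zeta5Search.DenomLaw.RuleR
import HarnessLib

/-!
# ζ(5) search — the PATH ACCOUNTING node on TOP_STAIR #1 = ray H1: `PathAccountingFirstPeriod`'s conclusion for `b(n)`, EVERY first-period prime, every `j`, all `n`

Cell `pub-zeta5` (HONEST FRAMING: systematic search; no irrationality claim unless certified), TRACK «DENOM-LAW» D1 prover seat
(denom-prover-d1 g13, `HOME/denom-law/prover-d1/ATTEMPT-13.md` §3).  The typed D2 node `DenomLaw.PathAccountingFirstPeriod` (Brown–Zudilin (28)+(30)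
transported by `G ≅ S₇`, in Casoratian form: `v_p(Cas₇) ≥ ⌊d/p⌋ − N_p − min([⌊d/p⌋ ≥ 2], 5 − C⋆)`) is proved here ON TOP_STAIR #1 = the census's T1-map
ray H1, `b(n) = n·(34; 14,13,12,11,10,9,8) = bLin (8n) (6n) n` — the STAIRCASE ray of the D1 track (STAIR multiset 17,16,15,14,14 vs BZ 17,16,15,15,14)
— for every `n ≥ 1`, EVERY direction `j` and EVERY first-period prime (on the ray the 28 forms are `< 2p` iff `2p > 17n`):
* `2p ≤ 25n` (`⌊d/p⌋ = 2`): cells `(8.5,9]`, `(9,10]`, `(10,11]`, `(11,34/3]` by `casLB` (`−11, −9, −9, −7`) with `C⋆ ≤ 11, 11, 9, 8`; `(34/3,12]` by the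
  DOUBLE DROP (`cas_ge_c11b`: `v ≥ −7 = casLB + 2`, value `2 − 12 + 3`); `(12,12.5)` by the COLLINEARITY RUNG (`cas_ge_c12a`: `v ≥ −6 = casLB + 1`, `C⋆ ≤ 6`,
  value `2 − 9 + 1`);
* `25n < 2p ≤ 50n` (`⌊d/p⌋ = 1`): `(12.5,13]` `casLB = −7`, `C⋆ ≤ 6`, value `1 − 9 + 1`; `(13,14]`, `(14,15]` (the STAIR cell: `v ≥ −3`, no prime of BZ's 4th
  level in `den P_n`), `(15,16]`, `(16,17]`, `(17,25]` by `casLB = −5, −3, −1, 0, 1` with `C⋆ ≤ 5`;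
* `p > 25n` (`⌊d/p⌋ = 0`): value `0`, `casLB ≥ 0`.
Assembled: `pathAccounting_h1` (any `j`, every prime with `2p > 17n`), `seventeen_lt_of_firstPeriod`, `pathAccountingFirstPeriod_h1` and
`pathAccountingFirstPeriod_on_h1` (the node's binders VERBATIM with `b := b(n)`).  So on all three long-row census rays (record: g11 `RecordRayPath`; flag:
g12 `FlagRayPath(C17a)`; TOP_STAIR #1: this file) the PATH node is a theorem for every `n`; the ∀-`b` node stays OPEN.  The census's letters windows
`RayH1LettersK001–K004` (`j = 7`, `n ≥ 2…8`) are instances.  MODEL/structure-side valuation bookkeeping; nothing about ζ(5); no γ; records in print UNMOVED.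
-/

open Finset

namespace Summit.KontsevichZagierPeriods.Zeta5Search.StairTS1

open Summit.KontsevichZagierPeriods.Zeta5Search.ClusterValuation
open Summit.KontsevichZagierPeriods.Zeta5Search.CasoratianValuation (InPolytope shift casoratian pairFloors refund)
open Summit.KontsevichZagierPeriods.Zeta5Search.WedgeDictionary (dOf)
open Summit.KontsevichZagierPeriods.Zeta5Search.CellKit (bLin)
open Summit.KontsevichZagierPeriods.Zeta5Search.DenomLaw (cStar FirstPeriod Sorted7)
open Summit.KontsevichZagierPeriods.Zeta5Search.DenomLaw.FirstPeriodKit (cStar_le_eleven)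

/-- `2p = 25n` is impossible for a prime `p` (else `5 ∣ p`, `p = 5`, `2 = 5n`). -/
theorem two_mul_ne_25 {n p : ℕ} (hprime : p.Prime) : 2 * p ≠ 25 * n := by
  intro heq
  have h5 : 5 ∣ p := by
    have : 5 ∣ 2 * p := ⟨5 * n, by omega⟩
    exact Nat.Coprime.dvd_of_dvd_mul_left (by norm_num) this
  have := (Nat.prime_dvd_prime_iff_eq (by norm_num) hprime).1 h5
  omega

/-- **`PathAccountingFirstPeriod`'s conclusion ON TOP_STAIR #1 for EVERY prime `p` with `2p > 17n`, every direction `j`, all `n ≥ 1`.** -/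
theorem pathAccounting_h1 (n j p : ℕ) (hn : 1 ≤ n) (hj1 : 1 ≤ j) (hj7 : j ≤ 7) (hprime : p.Prime) (h85 : 17 * n < 2 * p)
    (hcas : casoratian (bLin (8 * n) (6 * n) n) j ≠ 0) :
    dOf (bLin (8 * n) (6 * n) n) / (p : ℤ) - pairFloors (bLin (8 * n) (6 * n) n) p
        - min (if 2 ≤ dOf (bLin (8 * n) (6 * n) n) / (p : ℤ) then (1 : ℤ) else 0) (5 - (cStar (bLin (8 * n) (6 * n) n) p : ℤ))
      ≤ padicValRat p (casoratian (bLin (8 * n) (6 * n) n) j) := by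
  haveI : Fact p.Prime := ⟨hprime⟩
  have hp2 := odd_of_prime_gt85 hprime h85 hn
  have hLB := cas_ge_casLB hn hj1 hj7 hprime h85 hcas
  have hC11 : (cStar (bLin (8 * n) (6 * n) n) p : ℤ) ≤ 11 := by exact_mod_cast cStar_le_eleven _ p
  -- ⌊d/p⌋ = 2 : 8.5n < p ≤ 12.5n
  by_cases hfd2 : 2 * p ≤ 25 * n
  · rw [dOf_h1_div_two (by omega) hfd2, if_pos (le_refl _)]
    have hmin : -6 ≤ min (1 : ℤ) (5 - (cStar (bLin (8 * n) (6 * n) n) p : ℤ)) := le_min (by norm_num) (by linarith)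
    by_cases h : p ≤ 9 * n
    · rw [N_c8 h85 h]; linarith [casLB_c8 (n := n) (p := p) h85 (by omega) hp2]
    by_cases h' : p ≤ 10 * n
    · rw [N_c9 (by omega) h']; linarith [casLB_c9 (n := n) (p := p) (by omega) (by omega) hp2]
    by_cases h : p ≤ 11 * n
    · have hC : (cStar (bLin (8 * n) (6 * n) n) p : ℤ) ≤ 9 := by exact_mod_cast cStar_h1_le_nine (n := n) (p := p) (by omega)
      have hmin' : -4 ≤ min (1 : ℤ) (5 - (cStar (bLin (8 * n) (6 * n) n) p : ℤ)) := le_min (by norm_num) (by linarith)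
      rw [N_c10 (by omega) h]; linarith [casLB_c10 (n := n) (p := p) (by omega) (by omega) hp2]
    have hC : (cStar (bLin (8 * n) (6 * n) n) p : ℤ) ≤ 8 := by exact_mod_cast cStar_h1_le_eight (n := n) (p := p) (by omega)
    have hmin' : -3 ≤ min (1 : ℤ) (5 - (cStar (bLin (8 * n) (6 * n) n) p : ℤ)) := le_min (by norm_num) (by linarith)
    by_cases h' : 3 * p ≤ 34 * n
    · rw [N_c11 (by omega) (by omega)]; linarith [casLB_c11a (n := n) (p := p) (by omega) h' hp2]
    by_cases h : p ≤ 12 * n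
    · rw [N_c11 (by omega) h]; linarith [cas_ge_c11b hn hj1 hj7 hprime (by omega) h hcas]
    -- `12n < p < 12.5n`: the collinearity rung, `C⋆ ≤ 6`
    have h25 : 2 * p < 25 * n := lt_of_le_of_ne hfd2 (two_mul_ne_25 hprime)
    have hC6 : (cStar (bLin (8 * n) (6 * n) n) p : ℤ) ≤ 6 := by exact_mod_cast cStar_h1_le_six (n := n) (p := p) (by omega)
    have hmin6 : -1 ≤ min (1 : ℤ) (5 - (cStar (bLin (8 * n) (6 * n) n) p : ℤ)) := le_min (by norm_num) (by linarith)
    rw [N_c12 (by omega) (by omega)]; linarith [cas_ge_c12a hn hj1 hj7 hprime (by omega) h25 hcas]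
  push Not at hfd2
  -- ⌊d/p⌋ = 1 : 12.5n < p ≤ 25n
  by_cases hfd1 : p ≤ 25 * n
  · rw [dOf_h1_div_one hfd2 hfd1, if_neg (by norm_num)]
    by_cases h : p ≤ 13 * n
    · have hC : (cStar (bLin (8 * n) (6 * n) n) p : ℤ) ≤ 6 := by exact_mod_cast cStar_h1_le_six (n := n) (p := p) (by omega)
      have hmin : (-1 : ℤ) ≤ min (0 : ℤ) (5 - (cStar (bLin (8 * n) (6 * n) n) p : ℤ)) := le_min (by norm_num) (by linarith)
      rw [N_c12 (by omega) h]; linarith [casLB_c12b (n := n) (p := p) hfd2 (by omega) hp2]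
    have hC : (cStar (bLin (8 * n) (6 * n) n) p : ℤ) ≤ 5 := by exact_mod_cast cStar_h1_le_five (n := n) (p := p) (by omega)
    have hmin : (0 : ℤ) ≤ min (0 : ℤ) (5 - (cStar (bLin (8 * n) (6 * n) n) p : ℤ)) := le_min le_rfl (by linarith)
    by_cases h' : p ≤ 14 * n
    · rw [N_c13 (by omega) h']; linarith [casLB_c13 (n := n) (p := p) (by omega) (by omega) hp2]
    by_cases h : p ≤ 15 * n
    · rw [N_c14 (by omega) h]; linarith [casLB_c14 (n := n) (p := p) (by omega) (by omega) hp2]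
    by_cases h' : p ≤ 16 * n
    · rw [N_c15 (by omega) h']; linarith [casLB_c15 (n := n) (p := p) (by omega) (by omega) hp2]
    by_cases h : p ≤ 17 * n
    · rw [N_c16 (by omega) h]; linarith [casLB_c16 (n := n) (p := p) (by omega) (by omega) hp2]
    · rw [N_gt17 (by omega)]; linarith [casLB_c17 (n := n) (p := p) (by omega) (by omega) hp2]
  push Not at hfd1
  -- ⌊d/p⌋ = 0 : p > 25n
  rw [dOf_h1_div_zero hfd1, if_neg (by norm_num), N_gt17 (by omega)]
  have hC : (cStar (bLin (8 * n) (6 * n) n) p : ℤ) ≤ 5 := by exact_mod_cast cStar_h1_le_five (n := n) (p := p) (by omega)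
  have hmin : (0 : ℤ) ≤ min (0 : ℤ) (5 - (cStar (bLin (8 * n) (6 * n) n) p : ℤ)) := le_min le_rfl (by linarith)
  by_cases h34 : 34 * n < p
  · linarith [casLB_gt34 (n := n) h34]
  · linarith [casLB_c25 (n := n) (p := p) (by omega) (by omega) hp2]

/-- On the ray H1 the node's hypothesis `FirstPeriod` forces `17n < 2p` (the pair block `34n − 9n − 8n = 17n` is `< 2p`). -/
theorem seventeen_lt_of_firstPeriod {n p : ℕ} (h : FirstPeriod (bLin (8 * n) (6 * n) n) p) : 17 * n < 2 * p := by
  have := h.2 5 (by simp) 6 (by simp) (by norm_num)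
  simp only [Nat.reduceAdd, w0, w6, w7] at this
  have h' : (17 * n : ℤ) < 2 * p := by linarith
  exact_mod_cast h'

/-- **`PathAccountingFirstPeriod` ON TOP_STAIR #1 in the node's own hypotheses** (`FirstPeriod (b(n)) p`), every `j`, all `n ≥ 1`. -/
theorem pathAccountingFirstPeriod_h1 (n j p : ℕ) (hn : 1 ≤ n) (hj1 : 1 ≤ j) (hj7 : j ≤ 7) (hprime : p.Prime)
    (hfp : FirstPeriod (bLin (8 * n) (6 * n) n) p) (hcas : casoratian (bLin (8 * n) (6 * n) n) j ≠ 0) :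
    dOf (bLin (8 * n) (6 * n) n) / (p : ℤ) - pairFloors (bLin (8 * n) (6 * n) n) p
        - min (if 2 ≤ dOf (bLin (8 * n) (6 * n) n) / (p : ℤ) then (1 : ℤ) else 0) (5 - (cStar (bLin (8 * n) (6 * n) n) p : ℤ))
      ≤ padicValRat p (casoratian (bLin (8 * n) (6 * n) n) j) :=
  pathAccounting_h1 n j p hn hj1 hj7 hprime (seventeen_lt_of_firstPeriod hfp) hcas

/-- **The node `PathAccountingFirstPeriod` restricted to TOP_STAIR #1**, literally (all its binders, `b := b(n)`), all `n ≥ 1`. -/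
theorem pathAccountingFirstPeriod_on_h1 (n p : ℕ) (hn : 1 ≤ n) :
    InPolytope (bLin (8 * n) (6 * n) n) → Sorted7 (bLin (8 * n) (6 * n) n) → InPolytope (shift (bLin (8 * n) (6 * n) n) 7) → p.Prime → 5 ≤ p →
    (bLin (8 * n) (6 * n) n 0 + 2 : ℤ) < (p : ℤ) ^ 2 → FirstPeriod (bLin (8 * n) (6 * n) n) p → casoratian (bLin (8 * n) (6 * n) n) 7 ≠ 0 →
      dOf (bLin (8 * n) (6 * n) n) / (p : ℤ) - pairFloors (bLin (8 * n) (6 * n) n) p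
          - min (if 2 ≤ dOf (bLin (8 * n) (6 * n) n) / (p : ℤ) then (1 : ℤ) else 0) (5 - (cStar (bLin (8 * n) (6 * n) n) p : ℤ))
        ≤ padicValRat p (casoratian (bLin (8 * n) (6 * n) n) 7) :=
  fun _ _ _ hprime _ _ hfp hcas => pathAccountingFirstPeriod_h1 n 7 p hn (by norm_num) (by norm_num) hprime hfp hcas

/-- **PATH = STAIR on the staircase cell, for the record**: on `14n < p ≤ 15n` (BZ's 4th level `m₄ = 15`, STAIR's `14`) the node's value is
`1 − 4 − 0 = −3` and `v_p(Cas_j(b(n))) ≥ −3` for every `j`, all `n` — with `v_p(ρ_n) = 3` there, no prime of `(14n, 15n]` divides `den P_n`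
(the census's `RayH1Letters.K001.window` is the case `j = 7`, `n ≥ 2`). -/
theorem stairCell_h1 (n j p : ℕ) (hn : 1 ≤ n) (hj1 : 1 ≤ j) (hj7 : j ≤ 7) (hprime : p.Prime) (hA : 14 * n < p) (hB : p ≤ 15 * n)
    (hcas : casoratian (bLin (8 * n) (6 * n) n) j ≠ 0) : (-3 : ℤ) ≤ padicValRat p (casoratian (bLin (8 * n) (6 * n) n) j) := by
  haveI : Fact p.Prime := ⟨hprime⟩
  exact (casLB_c14 (by omega) (by omega) (odd_of_prime_gt85 hprime (by omega) hn)).trans (cas_ge_casLB hn hj1 hj7 hprime (by omega) hcas)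

end Summit.KontsevichZagierPeriods.Zeta5Search.StairTS1
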